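import Summits.NavierStokesRegularity.NavierStokesRegularity.Theorems.RungBlowupCofinal.Negative.AzimuthalLeibniz
import Summits.NavierStokesRegularity.FluidComputer.AngularGalerkinLadderLaplacian
import Summits.NavierStokesRegularity.NavierStokesRegularity.Theorems.RungBlowupCofinal.SectoralToroidalWaves
import HarnessLib

/-!
# The co-band-limitedness of the two defects is the ENTIRE dynamic content of the mean–wave
# profile system: every other conjunct is met by arbitrary compactly supported kinematic data
# (route `AngularGalerkinLadder`, crux K1 `RungBlowupCofinal`; Negative lane, theorems only)

Negative-lane bookkeeping for `stmt-NavierStokesRegularity-19959` (K1 of route №8), cell ns-blowup,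
refuter5 g6 (K5-90 companion), about the registered line `Cruxes/RungBlowupCofinal/Lines/qlwave.lean`
(v3; `Qlwave.IsMeanWaveProfile L n α C V W Q₀ Q₁ E₀ E₁`, stub 3 `stub_meanwave_profiles_cofinal`).
LOAD-BEARING ANALYSIS (hypothesis mutation): drop the two conjuncts
`IsCobandLimited L E₀ ∧ IsCobandLimited L E₁` from `IsMeanWaveProfile` and NOTHING is left to prove —
for ANY pair `(V, W)` of compactly supported fields meeting the six kinematic conjuncts
(band-limited of degree `≤ L`, divergence free, `J₃V = 0`, `J₃(J₃W) = −n²W`) inside the window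
`L < 2n`, and for EVERY precession rate `α`, the remaining conjuncts hold with zero pressures, the
residuals themselves as (continuous) defects, and the Type-I tail constant read off the compact
support. Since such kinematic pairs exist at every rung (circuit g11's sectoral toroidal waves,
`n = L ≥ 1`, built on the landed `ToroidalLift` / `SectoralHarmonics`), stub 3 with the co-band
clause deleted is true cofinally and trivially, and the
precession rate is pinned by nothing but that clause. Nothing here asserts a Theses declaration; no
definition, no named fact. WHAT THIS IS NOT: not Navier–Stokes evidence — continuity bookkeeping for
smooth compactly supported fields on `ℝ³`; no profile is constructed or excluded.

## Content

* **`meanWave_withoutCoband_of_kinematic`**: the conclusion is `Qlwave.IsMeanWaveProfile L n α C V W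
  Q₀ Q₁ E₀ E₁` VERBATIM with the two conjuncts `IsCobandLimited L E₀`, `IsCobandLimited L E₁` deleted
  (`IsZonal`, `IsAzimuthalWave`, `meanStress`, `waveConj` unfolded by `rfl`), existentially over
  `C, Q₀, Q₁, E₀, E₁`, from the kinematic sextet + compact support, for every `α`.
* `typeI_tail_of_hasCompactSupport`: `‖V y + W y‖ ≤ C/(‖y‖+1)` for compactly supported continuous
  `V, W`.
* **`meanWave_withoutCoband_all_rungs`** (APPEND, after circuit g11's p550909
  `SectoralToroidalWaves.exists_zonal_and_sectoral_wave`): at EVERY rung `L ≥ 1`, with the sectoral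
  fold `n = L` and for EVERY precession rate `α`, the co-band-free predicate is inhabited with
  `W ≢ 0` — i.e. `stub_meanwave_profiles_cofinal` with the two co-band conjuncts deleted is true at
  every rung (not merely cofinally), trivially.

Reading for provers/planners: any proof of stub 3 is a proof of `IsCobandLimited L E₀ ∧
IsCobandLimited L E₁` for the residuals of a kinematic pair and nothing else (by
`Negative/CobandGaussPairing` (p543914) these are the vanishing of the residual pairings against
compactly supported band-limited test fields — the Galerkin equations of rung `L` in the mean–wave
sector).
[cite: BullardGellman1954]
-/

noncomputable section

namespace Summit.NavierStokesRegularity.AngularGalerkinLadderMeanWaveCobandLoadBearing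

open Set Function
open scoped ContDiff RealInnerProductSpace Laplacian
open Literature.Analysis.FluidPDE
open Summit.NavierStokesRegularity.FluidComputer
open Summit.NavierStokesRegularity.FluidComputer.AngularLadder
open Summit.NavierStokesRegularity.AngularGalerkinLadderAzimuthalLeibniz

variable {L n : ℕ} {V W : EuclideanSpace ℝ (Fin 3) → EuclideanSpace ℝ (Fin 3)}

/-- **The Type-I tail conjunct is free for compactly supported data**: if `V, W` are continuous with
compact support then `‖V y + W y‖ ≤ C/(‖y‖ + 1)` for some `C`. [folklore] -/
theorem typeI_tail_of_hasCompactSupport (hVc : Continuous V) (hWc : Continuous W)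
    (hVs : HasCompactSupport V) (hWs : HasCompactSupport W) :
    ∃ C : ℝ, ∀ y, ‖V y + W y‖ ≤ C / (‖y‖ + 1) := by
  have hS : HasCompactSupport (fun y => (‖y‖ + 1) * ‖V y + W y‖) :=
    HasCompactSupport.mul_left (hVs.add hWs).norm
  have hc : Continuous (fun y => (‖y‖ + 1) * ‖V y + W y‖) := by fun_prop
  obtain ⟨C, hC⟩ := hc.bounded_above_of_compact_support hS
  refine ⟨C, fun y => ?_⟩
  have hpos : 0 < ‖y‖ + 1 := by positivity
  have h2 : (‖y‖ + 1) * ‖V y + W y‖ ≤ C := (Real.le_norm_self _).trans (hC y)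
  rw [le_div_iff₀ hpos]
  linarith [h2]

/-- The gradient of the zero pressure vanishes. [folklore] -/
theorem gradient_zero_fun (y : EuclideanSpace ℝ (Fin 3)) :
    gradient (fun _ : EuclideanSpace ℝ (Fin 3) => (0 : ℝ)) y = 0 := by
  simp [gradient]

/-- **Co-band-limitedness of the defects is the entire dynamic content of the mean–wave system.**
For every precession rate `α`, every fold window `L < 2n` and every pair of COMPACTLY SUPPORTED
fields `V, W` band-limited of degree `≤ L`, divergence free, with `J₃V = 0` and `J₃(J₃W) = −n²W`,
all conjuncts of `Qlwave.IsMeanWaveProfile L n α C V W Q₀ Q₁ E₀ E₁` other than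
`IsCobandLimited L E₀ ∧ IsCobandLimited L E₁` hold — with `Q₀ = Q₁ = 0`, `E₀, E₁` the residuals of
the zonal and wave equations (continuous), and `C` from the compact support. The conclusion below is
that predicate verbatim with the two co-band conjuncts deleted (`IsZonal V := ∀ y, angGen 2 V y = 0`,
`IsAzimuthalWave n W := ∀ y, angGen 2 (angGen 2 W) y = -(n² • W y)`,
`meanStress n W y := ½ • (convect W W y + convect W' W' y)`, `W' := fun y => n⁻¹ • angGen 2 W y`,
all by `rfl`). [folklore] -/
theorem meanWave_withoutCoband_of_kinematic (α : ℝ) (hLn : L < 2 * n) (hV : IsBandLimited L V)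
    (hW : IsBandLimited L W) (hdV : VectorCalculus.IsDivFree V) (hdW : VectorCalculus.IsDivFree W)
    (hz : ∀ y, angGen 2 V y = 0) (hw : ∀ y, angGen 2 (angGen 2 W) y = -(((n : ℝ) ^ 2) • W y))
    (hVs : HasCompactSupport V) (hWs : HasCompactSupport W) :
    ∃ (C : ℝ) (Q₀ Q₁ : EuclideanSpace ℝ (Fin 3) → ℝ)
      (E₀ E₁ : EuclideanSpace ℝ (Fin 3) → EuclideanSpace ℝ (Fin 3)),
      L < 2 * n ∧ IsBandLimited L V ∧ IsBandLimited L W ∧ VectorCalculus.IsDivFree V ∧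
      VectorCalculus.IsDivFree W ∧ (∀ y, angGen 2 V y = 0) ∧
      (∀ y, angGen 2 (angGen 2 W) y = -(((n : ℝ) ^ 2) • W y)) ∧
      ContDiff ℝ ∞ Q₀ ∧ ContDiff ℝ ∞ Q₁ ∧ Continuous E₀ ∧ Continuous E₁ ∧
      (∀ y, -(Δ V) y + (1 / 2 : ℝ) • V y + (1 / 2 : ℝ) • fderiv ℝ V y y + convect V V y +
          (1 / 2 : ℝ) • (convect W W y +
            convect (fun y => ((n : ℝ)⁻¹) • angGen 2 W y) (fun y => ((n : ℝ)⁻¹) • angGen 2 W y) y) +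
        gradient Q₀ y = E₀ y) ∧
      (∀ y, -(Δ W) y + (1 / 2 : ℝ) • W y + (1 / 2 : ℝ) • fderiv ℝ W y y + α • angGen 2 W y +
          convect V W y + convect W V y + gradient Q₁ y = E₁ y) ∧
      ∀ y, ‖V y + W y‖ ≤ C / (‖y‖ + 1) := by
  have hVsm : ContDiff ℝ ∞ V := hV.1
  have hWsm : ContDiff ℝ ∞ W := hW.1
  have hW'sm : ContDiff ℝ ∞ (fun y => ((n : ℝ)⁻¹) • angGen 2 W y) := (contDiff_angGen hWsm 2).const_smul _
  -- continuity of the building blocks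
  have cΔV : Continuous (Δ V) := hV.laplacian.1.continuous
  have cΔW : Continuous (Δ W) := hW.laplacian.1.continuous
  have cV : Continuous V := hVsm.continuous
  have cW : Continuous W := hWsm.continuous
  have cDV : Continuous (fun y => fderiv ℝ V y y) :=
    (hVsm.continuous_fderiv (by simp)).clm_apply continuous_id
  have cDW : Continuous (fun y => fderiv ℝ W y y) :=
    (hWsm.continuous_fderiv (by simp)).clm_apply continuous_id
  have cJW : Continuous (angGen 2 W) := (contDiff_angGen hWsm 2).continuous
  have cVV : Continuous (convect V V) := (contDiff_convect hVsm hVsm).continuous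
  have cWW : Continuous (convect W W) := (contDiff_convect hWsm hWsm).continuous
  have cW'W' : Continuous (convect (fun y => ((n : ℝ)⁻¹) • angGen 2 W y)
      (fun y => ((n : ℝ)⁻¹) • angGen 2 W y)) := (contDiff_convect hW'sm hW'sm).continuous
  have cVW : Continuous (convect V W) := (contDiff_convect hVsm hWsm).continuous
  have cWV : Continuous (convect W V) := (contDiff_convect hWsm hVsm).continuous
  obtain ⟨C, hC⟩ := typeI_tail_of_hasCompactSupport cV cW hVs hWs
  refine ⟨C, fun _ => 0, fun _ => 0,
    fun y => -(Δ V) y + (1 / 2 : ℝ) • V y + (1 / 2 : ℝ) • fderiv ℝ V y y + convect V V y +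
      (1 / 2 : ℝ) • (convect W W y +
        convect (fun y => ((n : ℝ)⁻¹) • angGen 2 W y) (fun y => ((n : ℝ)⁻¹) • angGen 2 W y) y),
    fun y => -(Δ W) y + (1 / 2 : ℝ) • W y + (1 / 2 : ℝ) • fderiv ℝ W y y + α • angGen 2 W y +
      convect V W y + convect W V y,
    hLn, hV, hW, hdV, hdW, hz, hw, contDiff_const, contDiff_const, ?_, ?_, fun y => ?_, fun y => ?_, hC⟩
  · fun_prop
  · fun_prop
  · rw [gradient_zero_fun, add_zero]
  · rw [gradient_zero_fun, add_zero]

/-- **Stub 3 without the co-band clause holds at EVERY rung, trivially.** For every `L ≥ 1` and every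
precession rate `α` there are `C, V, W, Q₀, Q₁, E₀, E₁` satisfying `Qlwave.IsMeanWaveProfile L L α C V W
Q₀ Q₁ E₀ E₁` with the two conjuncts `IsCobandLimited L E₀`, `IsCobandLimited L E₁` deleted (letters as
in `meanWave_withoutCoband_of_kinematic`), and `W ≢ 0`: the sectoral toroidal wave and the localised
zonal swirl of `SectoralToroidalWaves.exists_zonal_and_sectoral_wave` fed into
`meanWave_withoutCoband_of_kinematic`. Hence every bit of `stub_meanwave_profiles_cofinal` beyond
kinematics is the co-band-limitedness of the two residuals. [folklore] -/
theorem meanWave_withoutCoband_all_rungs (L : ℕ) (hL : 1 ≤ L) (α : ℝ) :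
    ∃ (C : ℝ) (V W : EuclideanSpace ℝ (Fin 3) → EuclideanSpace ℝ (Fin 3))
      (Q₀ Q₁ : EuclideanSpace ℝ (Fin 3) → ℝ)
      (E₀ E₁ : EuclideanSpace ℝ (Fin 3) → EuclideanSpace ℝ (Fin 3)),
      (L < 2 * L ∧ IsBandLimited L V ∧ IsBandLimited L W ∧ VectorCalculus.IsDivFree V ∧
      VectorCalculus.IsDivFree W ∧ (∀ y, angGen 2 V y = 0) ∧
      (∀ y, angGen 2 (angGen 2 W) y = -(((L : ℝ) ^ 2) • W y)) ∧
      ContDiff ℝ ∞ Q₀ ∧ ContDiff ℝ ∞ Q₁ ∧ Continuous E₀ ∧ Continuous E₁ ∧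
      (∀ y, -(Δ V) y + (1 / 2 : ℝ) • V y + (1 / 2 : ℝ) • fderiv ℝ V y y + convect V V y +
          (1 / 2 : ℝ) • (convect W W y +
            convect (fun y => ((L : ℝ)⁻¹) • angGen 2 W y) (fun y => ((L : ℝ)⁻¹) • angGen 2 W y) y) +
        gradient Q₀ y = E₀ y) ∧
      (∀ y, -(Δ W) y + (1 / 2 : ℝ) • W y + (1 / 2 : ℝ) • fderiv ℝ W y y + α • angGen 2 W y +
          convect V W y + convect W V y + gradient Q₁ y = E₁ y) ∧
      ∀ y, ‖V y + W y‖ ≤ C / (‖y‖ + 1)) ∧ ∃ y, W y ≠ 0 := by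
  obtain ⟨V, W, hV, hW, hdV, hdW, hz, hw, hVs, hWs, -, hW0⟩ :=
    AngularGalerkinLadderSectoralToroidal.exists_zonal_and_sectoral_wave hL le_rfl
  obtain ⟨C, Q₀, Q₁, E₀, E₁, h⟩ :=
    meanWave_withoutCoband_of_kinematic α (by omega) hV hW hdV hdW hz hw hVs hWs
  exact ⟨C, V, W, Q₀, Q₁, E₀, E₁, h, hW0⟩

end Summit.NavierStokesRegularity.AngularGalerkinLadderMeanWaveCobandLoadBearing
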